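import Literature.NumberTheory.GaloisRepresentations.ProfiniteIntersectionCocycleExtension
import Literature.NumberTheory.GaloisRepresentations.ContinuousCohomologyConnecting
import Mathlib.Topology.Algebra.ClopenNhdofOne
import Mathlib.Topology.Algebra.OpenSubgroup
import HarnessLib

/-!
# Route UniversalToricDescent — `H¹(Q, T) = H²(Q, T) = 0` for a pro-prime-to-`p` profinite group `Q`
# acting (arbitrarily, continuously) on a discrete `p`-primary module `T`

Lead prover bsd-wall-utd-p1 g9 (`--supports stmt-BirchSwinnertonDyer-20399`; the engine of the
Greenberg–Vatsal Prop. (2.4) local term `s_v` of `UniversalToricDescentSigmaLocalFinite`, memo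
ALG-HALF-21845-LOCAL §3). Serre, *Cohomologie galoisienne*, I §3.3 Cor. 2 to Prop. 14: a profinite group
whose (supernatural) order is prime to `p` has `cd_p = 0`, i.e. `Hⁿ(Q, T) = 0` for `n ≥ 1` and every
discrete `p`-primary torsion `Q`-module `T`. The tree has the case of the TRIVIAL action on `ℤ/pⁿ`
(`CoprimeIndexZModVanishing`) and the relative crossed-homomorphism form
(`EisensteinPrimesProPrimeToPCocycleVanishing`); this file proves the degrees `1` and `2` for an
ARBITRARY continuous action (`ρ : ContinuousRep Q ℤ T`), which is what the Hochschild–Serre count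
`HochschildSerreLowDegree.natCard_one_eq_mul` consumes at the quotient `Gal(K_v^{nr}/K_{∞,w}) = D/I`
(pro-prime-to-`p` at a place `v ∤ p` finitely decomposed in a `ℤ_p`-extension,
`Iwasawa.NonsplitTower.relIndex_sup_inertia_coprime`):

* `subsingleton_continuousCohomology_one_of_coprime_index` — **`H¹(Q, T) = 0`**: a continuous crossed
  homomorphism `f` vanishes on an open normal subgroup `W` (so is right-`W`-invariant); with
  `d = (Q : W)` (prime to `p`) and `s = Σ_{q ∈ Q/W} f(q)`, `d·f(g) = s − g·s` (the averaging identity,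
  [NSW (1.6.2)]) and Bézout `a d + b p^k = 1` give `f = ∂(−a s)`.
* `subsingleton_continuousCohomology_two_of_coprime_index` — **`H²(Q, T) = 0`**: a continuous
  `2`-cocycle `c` is constant on the cosets of an open normal `W` (uniform local constancy,
  `exists_nhds_one_forall_eq'`); with `B(σ) = Σ_{q ∈ Q/W} c(σ, q)` the cocycle identity summed over the
  last variable reads `d·c(σ, τ) = σB(τ) − B(στ) + B(σ)`, so `c = ∂(a B)`.

No hypothesis on `p` (any natural number); the values of a continuous cochain on the compact `Q` are
uniformly `p^k`-torsion. THEOREMS ONLY; no definition, no named fact, no `sorry`. BSD is not advanced by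
this file.
References: [SerreGaloisCohomology1997] I §2.2 Prop. 8, I §3.3 Prop. 14 Cor. 2; [NeukirchSchmidtWingberg2008]
(1.6.2); [GreenbergVatsal2000] §2 Prop. (2.4) (proof: "`G_{(ℚ_∞)_η}/I_η` has profinite order prime to `p`").
-/

set_option autoImplicit false
-- `…BirchSwinnertonDyer.BirchSwinnertonDyer.Theorems…` is the problem's mandated namespace (D-0017).
set_option linter.dupNamespace false

noncomputable section

open scoped Classical

namespace Summit.BirchSwinnertonDyer.BirchSwinnertonDyer.Theorems.UniversalToricDescentProPrimeToP

open Literature.NumberTheory.GaloisRepresentations ContinuousCohomology Topology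

variable {G : Type} [Group G] [TopologicalSpace G] [IsTopologicalGroup G] [CompactSpace G]
  [TotallyDisconnectedSpace G]
variable {M : Type} [AddCommGroup M] [TopologicalSpace M] [DiscreteTopology M]
variable (ρ : ContinuousRep G ℤ M) {p : ℕ}

/-! ### Uniform exponents and Bézout -/

omit [IsTopologicalGroup G] [TotallyDisconnectedSpace G] in
/-- A continuous map from a compact space to a discrete `p`-primary group is killed by ONE power of `p`
(its image is finite). [folklore] -/
theorem exists_forall_pow_smul_eq_zero {X : Type} [TopologicalSpace X] [CompactSpace X]
    (hM : ∀ m : M, ∃ k : ℕ, p ^ k • m = 0) {f : X → M} (hf : Continuous f) :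
    ∃ k : ℕ, ∀ x, p ^ k • f x = 0 := by
  choose k hk using hM
  obtain ⟨N, hN⟩ := ((isCompact_range hf).finite_of_discrete.image k).bddAbove
  refine ⟨N, fun x ↦ ?_⟩
  have hle : k (f x) ≤ N := hN (Set.mem_image_of_mem k (Set.mem_range_self x))
  rw [← Nat.sub_add_cancel hle, pow_add, mul_smul, hk, smul_zero]

omit [TopologicalSpace M] [DiscreteTopology M] in
/-- Bézout: if `d` is prime to `p` and `p^k m = 0` then `m = a • (d • m)` for an integer `a`
independent of `m`. [folklore] -/
theorem exists_int_forall_eq_smul_nsmul {d : ℕ} (hd : d.Coprime p) (k : ℕ) :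
    ∃ a : ℤ, ∀ m : M, p ^ k • m = 0 → m = a • ((d : ℤ) • m) := by
  have hdk : (d : ℤ).gcd ((p ^ k : ℕ) : ℤ) = 1 := by
    rw [Int.gcd_natCast_natCast]
    exact Nat.Coprime.pow_right k hd
  obtain ⟨a, b, hab⟩ : ∃ a b : ℤ, 1 = (d : ℤ) * a + ((p ^ k : ℕ) : ℤ) * b := by
    refine ⟨(d : ℤ).gcdA ((p ^ k : ℕ) : ℤ), (d : ℤ).gcdB ((p ^ k : ℕ) : ℤ), ?_⟩
    have h := Int.gcd_eq_gcd_ab (d : ℤ) ((p ^ k : ℕ) : ℤ)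
    rwa [hdk, Nat.cast_one] at h
  refine ⟨a, fun m hm ↦ ?_⟩
  have hm' : ((p ^ k : ℕ) : ℤ) • m = 0 := by rw [natCast_zsmul]; exact hm
  calc m = (1 : ℤ) • m := (one_zsmul m).symm
    _ = ((d : ℤ) * a + ((p ^ k : ℕ) : ℤ) * b) • m := by rw [← hab]
    _ = a • ((d : ℤ) • m) := by
        rw [add_smul, mul_comm, mul_smul, mul_comm, mul_smul, hm', smul_zero, add_zero]

/-! ### `H¹(Q, T) = 0` -/

/-- **`H¹(Q, T) = 0` for a pro-prime-to-`p` profinite `Q` and a discrete `p`-primary `Q`-module `T`**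
(arbitrary continuous action): every open normal subgroup of `Q` has index prime to `p`, every
element of `T` is killed by a power of `p`. Proof: a continuous crossed homomorphism vanishes on an
open normal `W`; averaging over `Q/W` (order `d` prime to `p`) gives `d f = ∂(−s)`, and Bézout.
[cite: SerreGaloisCohomology1997, I §3.3 Prop. 14 Cor. 2] [cite: NeukirchSchmidtWingberg2008, (1.6.2)] -/
theorem subsingleton_continuousCohomology_one_of_coprime_index
    (hcop : ∀ U : Subgroup G, U.Normal → IsOpen (U : Set G) → U.index.Coprime p)
    (hM : ∀ m : M, ∃ k : ℕ, p ^ k • m = 0) :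
    Subsingleton (continuousCohomology 1 ρ.toTopRep) := by
  set X := ρ.toTopRep with hX
  refine ⟨fun x y ↦ ?_⟩
  suffices h : ∀ x : continuousCohomology 1 X, x = 0 by rw [h x, h y]
  intro x
  obtain ⟨φ, rfl⟩ := oneCocycleClass_surjective X x
  rw [oneCocycleClass_eq_zero_iff]
  -- the crossed homomorphism `f`
  have hf : ∀ g h : G, φ.1 (g * h) = φ.1 g + ρ g (φ.1 h) := fun g h ↦ φ.2 g h
  have hf1 : φ.1 1 = 0 := contOneCocycles.apply_one φ
  -- an open normal subgroup on which `f` vanishes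
  have hU : IsOpen (φ.1 ⁻¹' {0}) := (isOpen_discrete _).preimage φ.1.continuous
  obtain ⟨W, hW⟩ := ProfiniteGrp.exist_openNormalSubgroup_sub_open_nhds_of_one hU (by
    show φ.1 1 ∈ ({0} : Set M)
    rw [hf1]; rfl)
  have hfW : ∀ w ∈ W, φ.1 w = 0 := fun w hw ↦ hW hw
  have hright : ∀ (g : G) (w : G), w ∈ W → φ.1 (g * w) = φ.1 g := fun g w hw ↦ by
    rw [hf, hfW w hw, map_zero, add_zero]
  -- the finite quotient
  haveI : Finite (G ⧸ W.toSubgroup) := Subgroup.quotient_finite_of_isOpen W.toSubgroup W.isOpen'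
  letI : Fintype (G ⧸ W.toSubgroup) := Fintype.ofFinite _
  set Q := G ⧸ W.toSubgroup with hQ
  set d : ℕ := Fintype.card Q with hd
  have hdcop : d.Coprime p := by
    have h := hcop W.toSubgroup inferInstance W.isOpen'
    rwa [Subgroup.index_eq_card, Nat.card_eq_fintype_card] at h
  -- `f` is constant on cosets
  have hout : ∀ (g : G) (q : Q), φ.1 ((g • q).out) = φ.1 (g * q.out) := fun g q ↦ by
    induction q using QuotientGroup.induction_on with
    | H x =>
      obtain ⟨w, hw⟩ := QuotientGroup.mk_out_eq_mul W.toSubgroup x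
      obtain ⟨w', hw'⟩ := QuotientGroup.mk_out_eq_mul W.toSubgroup (g * x)
      rw [MulAction.Quotient.smul_mk, smul_eq_mul, hw', hw, ← mul_assoc, hright _ _ w'.2,
        hright _ _ w.2]
  -- the averaging identity `d • f g = s - g • s`
  set s : M := ∑ q : Q, φ.1 q.out with hs
  have havg : ∀ g : G, (d : ℤ) • φ.1 g = s - ρ g s := fun g ↦ by
    have hsum : ∑ q : Q, φ.1 ((g • q).out) = s :=
      Fintype.sum_equiv (MulAction.toPerm g) _ _ (fun q ↦ rfl)
    have hterm : ∀ q : Q, φ.1 ((g • q).out) = φ.1 g + ρ g (φ.1 q.out) := fun q ↦ by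
      rw [hout, hf]
    simp_rw [hterm, Finset.sum_add_distrib, Finset.sum_const, Finset.card_univ, ← map_sum] at hsum
    rw [← hd] at hsum
    rw [natCast_zsmul, eq_sub_iff_add_eq]
    exact hsum
  -- uniform exponent and Bézout
  obtain ⟨k, hk⟩ := exists_forall_pow_smul_eq_zero (X := G) hM φ.1.continuous
  obtain ⟨a, ha⟩ := exists_int_forall_eq_smul_nsmul (M := M) hdcop k
  refine ⟨-(a • s), fun g ↦ ?_⟩
  rw [ha (φ.1 g) (hk g), havg g, map_neg, map_zsmul, smul_sub]
  change a • s - a • (ρ g) s = -(a • (ρ g) s) - -(a • s)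
  abel

/-! ### `H²(Q, T) = 0` -/

variable [T2Space G]

/-- **`H²(Q, T) = 0` for a pro-prime-to-`p` profinite `Q` and a discrete `p`-primary `Q`-module `T`**
(arbitrary continuous action). Proof: a continuous `2`-cocycle `c` is constant on the cosets of an open
normal `W` (uniform local constancy); with `B(σ) = Σ_{q ∈ Q/W} c(σ, q)` the cocycle identity summed
over the last variable gives `d·c = ∂B`, `d = (Q : W)` prime to `p`, and Bézout.
[cite: SerreGaloisCohomology1997, I §3.3 Prop. 14 Cor. 2] [cite: NeukirchSchmidtWingberg2008, (1.6.2)] -/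
theorem subsingleton_continuousCohomology_two_of_coprime_index
    (hcop : ∀ U : Subgroup G, U.Normal → IsOpen (U : Set G) → U.index.Coprime p)
    (hM : ∀ m : M, ∃ k : ℕ, p ^ k • m = 0) :
    Subsingleton (continuousCohomology 2 ρ.toTopRep) := by
  set X := ρ.toTopRep with hX
  refine ⟨fun x y ↦ ?_⟩
  suffices h : ∀ x : continuousCohomology 2 X, x = 0 by rw [h x, h y]
  intro x
  obtain ⟨c, rfl⟩ := twoCocycleClass_surjective X x
  rw [twoCocycleClass_eq_zero_iff]
  have hc : ∀ σ τ υ : G, ρ σ (c.1 (τ, υ)) + c.1 (σ, τ * υ) = c.1 (σ * τ, υ) + c.1 (σ, τ) :=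
    fun σ τ υ ↦ c.2 σ τ υ
  -- Step 1: `c` is constant on the cosets of an open normal subgroup `W`
  obtain ⟨V, hV, hVc⟩ := exists_nhds_one_forall_eq' (X := G × G) (P := G × G)
    (fun z v ↦ c.1 (z * v)) (c.1.continuous.comp continuous_mul)
  obtain ⟨V₁, hV₁, V₂, hV₂, hV₁₂⟩ := mem_nhds_prod_iff.1 hV
  have h1 : (1 : G) ∈ interior (V₁ ∩ V₂) := mem_interior_iff_mem_nhds.2 (Filter.inter_mem hV₁ hV₂)
  obtain ⟨W, hW⟩ := ProfiniteGrp.exist_openNormalSubgroup_sub_open_nhds_of_one isOpen_interior h1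
  have hW' : (W : Set G) ⊆ V₁ ∩ V₂ := hW.trans interior_subset
  have hadapt : ∀ s t w w' : G, w ∈ W → w' ∈ W → c.1 (s * w, t * w') = c.1 (s, t) := by
    intro s t w w' hw hw'
    have h := hVc (s, t) (w, w') (hV₁₂ (Set.mk_mem_prod (hW' hw).1 (hW' hw').2))
    rwa [mul_one] at h
  -- Step 2: the finite quotient, of order `d` prime to `p`
  haveI : Finite (G ⧸ W.toSubgroup) := Subgroup.quotient_finite_of_isOpen W.toSubgroup W.isOpen'
  letI : Fintype (G ⧸ W.toSubgroup) := Fintype.ofFinite _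
  set Q := G ⧸ W.toSubgroup with hQ
  set d : ℕ := Fintype.card Q with hd
  have hdcop : d.Coprime p := by
    have h := hcop W.toSubgroup inferInstance W.isOpen'
    rwa [Subgroup.index_eq_card, Nat.card_eq_fintype_card] at h
  have hout : ∀ (σ τ : G) (q : Q), c.1 (σ, (τ • q).out) = c.1 (σ, τ * q.out) := fun σ τ q ↦ by
    induction q using QuotientGroup.induction_on with
    | H x =>
      obtain ⟨w, hw⟩ := QuotientGroup.mk_out_eq_mul W.toSubgroup x
      obtain ⟨w', hw'⟩ := QuotientGroup.mk_out_eq_mul W.toSubgroup (τ * x)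
      rw [MulAction.Quotient.smul_mk, smul_eq_mul, hw', hw, ← mul_assoc]
      have h1 := hadapt σ (τ * x) 1 w' W.toSubgroup.one_mem w'.2
      have h2 := hadapt σ (τ * x) 1 w W.toSubgroup.one_mem w.2
      rw [mul_one] at h1 h2
      rw [h1, h2]
  -- Step 3: the averaged `1`-cochain `B`
  let B : C(G, M) :=
    ⟨fun σ ↦ ∑ q : Q, c.1 (σ, q.out),
      continuous_finsetSum _ fun q _ ↦ c.1.continuous.comp (continuous_id.prodMk continuous_const)⟩
  have hB : ∀ σ, B σ = ∑ q : Q, c.1 (σ, q.out) := fun _ ↦ rfl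
  have havg : ∀ σ τ : G, (d : ℤ) • c.1 (σ, τ) = ρ σ (B τ) - B (σ * τ) + B σ := fun σ τ ↦ by
    have hsum : ∑ q : Q, c.1 (σ, (τ • q).out) = B σ :=
      Fintype.sum_equiv (MulAction.toPerm τ) _ _ (fun q ↦ rfl)
    have hterm : ∀ q : Q, c.1 (σ, (τ • q).out) =
        c.1 (σ * τ, q.out) + c.1 (σ, τ) - ρ σ (c.1 (τ, q.out)) := fun q ↦ by
      rw [hout, eq_sub_iff_add_eq, add_comm, hc]
    simp_rw [hterm, Finset.sum_sub_distrib, Finset.sum_add_distrib, Finset.sum_const,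
      Finset.card_univ, ← map_sum] at hsum
    rw [← hd, ← hB, ← hB] at hsum
    rw [natCast_zsmul, ← hsum]
    abel
  -- Step 4: uniform exponent and Bézout
  obtain ⟨k, hk⟩ := exists_forall_pow_smul_eq_zero (X := G × G) hM c.1.continuous
  obtain ⟨a, ha⟩ := exists_int_forall_eq_smul_nsmul (M := M) hdcop k
  refine ⟨a • B, fun σ τ ↦ ?_⟩
  rw [ha (c.1 (σ, τ)) (hk (σ, τ)), havg σ τ]
  simp only [ContinuousMap.smul_apply, smul_sub, smul_add, map_zsmul]
  rfl

end Summit.BirchSwinnertonDyer.BirchSwinnertonDyer.Theorems.UniversalToricDescentProPrimeToP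

end
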